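import Mathlib

/-!
# The invariant / anti-invariant decomposition for a quadratic extension
(kernel witness for the linear-algebra core of Lemma N5.L7 [A9] of the toric-period section:
«write `y = y₊ + y₋` with `ȳ₋ = −y₋`; the anti-invariant elements of `E_v` form the `F_v`-line
`F_v·δ`, so `δ/y₋ ∈ F_v^×`»)

For a field extension `E/F` with an `F`-algebra involution `σ` (`σ ∘ σ = id`) and `2 ≠ 0`:

* `decomposition` — every `y` is `y₊ + y₋` with `σ y₊ = y₊`, `σ y₋ = −y₋`
  (`y₊ = (y + σ y)/2`, `y₋ = (y − σ y)/2`);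
* `exists_eq_algebraMap_mul_of_anti` — **if the fixed points of `σ` are exactly `F`, the
  anti-invariant elements form the `F`-line through any non-zero anti-invariant `δ`**
  (`y/δ` is `σ`-invariant);
* `mem_range_algebraMap_of_fixed_of_quadratic` — for a Galois extension of degree `2` and
  `σ ≠ 1`, the fixed points of `σ` are exactly `F` (Mathlib:
  `IsGalois.mem_range_algebraMap_iff_fixed` + `mem_zpowers_of_prime_card`);
* `exists_eq_algebraMap_mul_of_anti_of_quadratic` — the line statement for a quadratic Galois
  extension, as used in N5.L7.

The valuation estimates of N5.L7 (`v_E(y₊) − v_E(y) ≥ m − C₀`, etc.) are not modelled.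
Mathlib-only; axioms standard.  Uses an L-value-free non-vanishing device: NO (README §8(d)).
-/

namespace Summit.Ventures.HodgeRepro2.T5QuadraticInvolution

section Abstract

variable {F E : Type*} [Field F] [Field E] [Algebra F E]

/-- The invariant / anti-invariant decomposition `y = (y + σ y)/2 + (y − σ y)/2` for an
`F`-algebra involution `σ` of `E` (characteristic `≠ 2`). -/
theorem decomposition [NeZero (2 : E)] (σ : E →ₐ[F] E) (hσ : ∀ x, σ (σ x) = x) (y : E) :
    σ ((y + σ y) / 2) = (y + σ y) / 2 ∧ σ ((y - σ y) / 2) = -((y - σ y) / 2) ∧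
      y = (y + σ y) / 2 + (y - σ y) / 2 := by
  refine ⟨?_, ?_, ?_⟩
  · rw [map_div₀, map_add, hσ, map_ofNat, add_comm]
  · rw [map_div₀, map_sub, hσ, map_ofNat, ← neg_div, neg_sub]
  · have h2 : (2 : E) ≠ 0 := NeZero.ne 2
    field_simp
    ring

/-- If the fixed points of `σ` are exactly `F`, then every anti-invariant `y` is an `F`-multiple
of any non-zero anti-invariant `δ`: `y/δ` is `σ`-invariant. -/
theorem exists_eq_algebraMap_mul_of_anti (σ : E →ₐ[F] E)
    (hfix : ∀ x, σ x = x → x ∈ Set.range (algebraMap F E)) {δ y : E} (hδ : σ δ = -δ)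
    (hδ0 : δ ≠ 0) (hy : σ y = -y) : ∃ c : F, y = algebraMap F E c * δ := by
  have hinv : σ (y / δ) = y / δ := by
    rw [map_div₀, hδ, hy, neg_div_neg_eq]
  obtain ⟨c, hc⟩ := hfix _ hinv
  exact ⟨c, by rw [hc, div_mul_cancel₀ y hδ0]⟩

/-- The quotient of two non-zero anti-invariant elements lies in `F` (`δ/y₋ ∈ F_v^×` of N5.L7). -/
theorem div_mem_range_of_anti (σ : E →ₐ[F] E)
    (hfix : ∀ x, σ x = x → x ∈ Set.range (algebraMap F E)) {δ y : E} (hδ : σ δ = -δ)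
    (hy : σ y = -y) : δ / y ∈ Set.range (algebraMap F E) := by
  apply hfix
  rw [map_div₀, hδ, hy, neg_div_neg_eq]

end Abstract

section Quadratic

variable {F E : Type*} [Field F] [Field E] [Algebra F E] [FiniteDimensional F E] [IsGalois F E]

/-- For a Galois extension of degree `2` and a non-trivial automorphism `σ`, the fixed points of
`σ` are exactly `F` (`σ` generates the Galois group of prime order `2`). -/
theorem mem_range_algebraMap_of_fixed_of_quadratic (h2 : Module.finrank F E = 2)
    (σ : E ≃ₐ[F] E) (hσ : σ ≠ 1) {x : E} (hx : σ x = x) : x ∈ Set.range (algebraMap F E) := by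
  rw [IsGalois.mem_range_algebraMap_iff_fixed]
  intro f
  have hcard : Nat.card (E ≃ₐ[F] E) = 2 := by rw [IsGalois.card_aut_eq_finrank, h2]
  haveI : Fact (Nat.Prime 2) := ⟨Nat.prime_two⟩
  have hst : σ ∈ MulAction.stabilizer (E ≃ₐ[F] E) x := by
    rw [MulAction.mem_stabilizer_iff]
    exact hx
  have hf : f ∈ MulAction.stabilizer (E ≃ₐ[F] E) x :=
    Subgroup.zpowers_le.mpr hst (mem_zpowers_of_prime_card hcard hσ)
  exact MulAction.mem_stabilizer_iff.mp hf

/-- **The anti-invariant line of a quadratic Galois extension**: for `σ ≠ 1`, `σ δ = −δ`,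
`δ ≠ 0` and `σ y = −y`, `y = c·δ` with `c ∈ F`. -/
theorem exists_eq_algebraMap_mul_of_anti_of_quadratic (h2 : Module.finrank F E = 2)
    (σ : E ≃ₐ[F] E) (hσ : σ ≠ 1) {δ y : E} (hδ : σ δ = -δ) (hδ0 : δ ≠ 0) (hy : σ y = -y) :
    ∃ c : F, y = algebraMap F E c * δ :=
  exists_eq_algebraMap_mul_of_anti (σ : E →ₐ[F] E)
    (fun _ hx => mem_range_algebraMap_of_fixed_of_quadratic h2 σ hσ hx) hδ hδ0 hy

end Quadratic

section Basis

variable {F E : Type*} [Field F] [Field E] [Algebra F E]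

/-- **`E = F ⊕ F·δ`** (the linear-algebra half of (A1′): `E_v/F_v ≅ F_v` as a one-dimensional
`F_v`-space): for an involution `σ` with fixed points exactly `F`, `2 ≠ 0`, and a non-zero
anti-invariant `δ`, every `y` is `a + c·δ` with `a, c ∈ F` (`a = (y + σ y)/2`, `c·δ = (y − σ y)/2`). -/
theorem exists_eq_add_mul [NeZero (2 : E)] (σ : E →ₐ[F] E) (hσ : ∀ x, σ (σ x) = x)
    (hfix : ∀ x, σ x = x → x ∈ Set.range (algebraMap F E)) {δ : E} (hδ : σ δ = -δ) (hδ0 : δ ≠ 0)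
    (y : E) : ∃ a c : F, y = algebraMap F E a + algebraMap F E c * δ := by
  obtain ⟨hplus, hminus, hsum⟩ := decomposition σ hσ y
  obtain ⟨a, ha⟩ := hfix _ hplus
  obtain ⟨c, hc⟩ := exists_eq_algebraMap_mul_of_anti σ hfix hδ hδ0 hminus
  exact ⟨a, c, by rw [ha, ← hc]; exact hsum⟩

/-- The coefficients are unique: `a + c·δ = 0` with `a, c ∈ F` forces `a = c = 0`
(`δ ∉ F` since `σ δ = −δ ≠ δ`). -/
theorem eq_zero_of_add_mul_eq_zero [NeZero (2 : E)] (σ : E →ₐ[F] E) {δ : E} (hδ : σ δ = -δ)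
    (hδ0 : δ ≠ 0) {a c : F} (h : algebraMap F E a + algebraMap F E c * δ = 0) : a = 0 ∧ c = 0 := by
  -- apply `σ`: `a − c·δ = 0`; subtract: `2 c δ = 0`, so `c = 0`, then `a = 0`
  have h' : algebraMap F E a - algebraMap F E c * δ = 0 := by
    have := congrArg σ h
    rwa [map_add, map_mul, AlgHom.commutes, AlgHom.commutes, hδ, map_zero, mul_neg,
      ← sub_eq_add_neg] at this
  have h2 : (2 : E) * (algebraMap F E c * δ) = 0 := by
    have := congrArg₂ (· - ·) h h'
    simp only [sub_zero] at this
    rw [← this]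
    ring
  have hc : c = 0 := by
    rcases mul_eq_zero.mp h2 with h2 | h2
    · exact absurd h2 (NeZero.ne 2)
    · rcases mul_eq_zero.mp h2 with h3 | h3
      · exact (map_eq_zero (algebraMap F E)).mp h3
      · exact absurd h3 hδ0
  refine ⟨?_, hc⟩
  rw [hc, map_zero, zero_mul, add_zero] at h
  exact (map_eq_zero (algebraMap F E)).mp h

end Basis

end Summit.Ventures.HodgeRepro2.T5QuadraticInvolution
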